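import Summits.MatrixMultiplication.MatrixMultiplication.Theorems.AbelianSTPPCensusShapeCertDefs

/-!
# Abelian STPP census — kernel evaluation of the `ShapeCert` checker (G: orders 120, 121, 122, 123, 124)

`check M = true` by `decide +kernel` (no `native_decide`), one theorem per order (per range of small orders),
so that every kernel run starts with empty caches and stays under the default heartbeat budget
(≈ 2–6 s per order below 100, up to ≈ 30 s at the orders 125 and 127).
Consumed by `…ShapeCertFinal` (`check_le_127`).
-/

set_option linter.dupNamespace false -- `MatrixMultiplication.MatrixMultiplication` (summit = problem, D-0017)
set_option autoImplicit false

namespace Summit.MatrixMultiplication.MatrixMultiplication.Theorems.ShapeCert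

/-- certificate check at order `120` (kernel evaluation) -/
theorem check_120 : check 120 = true := by decide +kernel

/-- certificate check at order `121` (kernel evaluation) -/
theorem check_121 : check 121 = true := by decide +kernel

/-- certificate check at order `122` (kernel evaluation) -/
theorem check_122 : check 122 = true := by decide +kernel

/-- certificate check at order `123` (kernel evaluation) -/
theorem check_123 : check 123 = true := by decide +kernel

/-- certificate check at order `124` (kernel evaluation) -/
theorem check_124 : check 124 = true := by decide +kernel

end Summit.MatrixMultiplication.MatrixMultiplication.Theorems.ShapeCert
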